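import Mathlib
import Summits.Ventures.PercRepro.TriangleCapEqualityLocus
import Summits.Ventures.PercRepro.TriangleCapClosedFormConjecture

/-!
# PercRepro — THE MAXIMISERS OF THE CHERRY TABLE IN THE COORDINATES `(k, m)` (p3, gen 41; part 169)

The equality locus of part 168 read on the table's own coordinates: for `k ≥ 6` and `2k − 3 ≤ m ≤ k²/4` let
`δ = a (k − a)` be the least product above `m` (`a ≥ 3`, `2a + r ≤ k`, `r = δ − m`; part 164). Then, when
`k ≥ r + 7`, a `K₄⁻`-free graph on `Fin k` with `m` edges attains the maximum `(m (k − 2) − r (k − 1 − r)) / 2`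
of `Σ_v C(d(v), 2)` iff it is `K_{a, k−a}` minus a star of `r` edges at one vertex (`cherry_table_maximisers`).
In particular on the diagonal cells `m = a (k − a)` (`r = 0`) the maximisers are exactly the complete bipartite
graphs `K_{a, k−a}` for every `k ≥ 7`, and one below the diagonal (`r = 1`, `k ≥ 8`) exactly `K_{a, k−a}` minus
an edge. Axioms: standard.
-/

namespace PercRepro

namespace TriangleCap

namespace C047

open Finset

variable {V : Type*} [Fintype V] [DecidableEq V]

/-- **THE MAXIMISERS OF THE CHERRY TABLE, `(k, m)` FORM:** for `6 ≤ k`, `2k − 3 ≤ m`, `4m ≤ k²` there are the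
row `a ≥ 3` and the distance `r` with `a (k − a) = m + r` the least product above `m` (`2a + r ≤ k`), and when
`r + 7 ≤ k` a `K₄⁻`-free graph on `Fin k` with `m` edges attains `2·Σ_v C(d(v), 2) + r (k − 1 − r) = m (k − 2)`
iff it is `K_{a, k−a}` minus a star of `r` edges at one vertex. -/
theorem cherry_table_maximisers (k m : ℕ) (hk6 : 6 ≤ k) (hm1 : 2 * k ≤ m + 3) (hm2 : 4 * m ≤ k * k) :
    ∃ a r, 3 ≤ a ∧ 2 * a + r ≤ k ∧ a * (k - a) = m + r ∧
      (∀ a', a' ≤ k → m ≤ a' * (k - a') → a * (k - a) ≤ a' * (k - a')) ∧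
      (r + 7 ≤ k → ∀ (D : SimpleGraph (Fin k)) [DecidableRel D.Adj], K4mFree D → D.edgeFinset.card = m →
        (2 * cherries D + r * (k - 1 - r) = m * (k - 2) ↔
          ∃ (A : Finset (Fin k)) (v : Fin k), A.card = a ∧ BipSub D A ∧ MissingStar D A v)) := by
  obtain ⟨a, r, ha, hak, hm⟩ := exists_cell k m hk6 hm1 hm2
  refine ⟨a, r, ha, hak, hm, least_prod_of_cell k a r m ha hak hm, ?_⟩
  intro hk7 D _ hK hD
  have hD' : D.edgeFinset.card = a * (k - a) - r := by rw [hm]; omega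
  have h := closed_form_equality_locus k a r ha hak hk7 D hK hD'
  have e : a * (k - a) - r = m := by omega
  rw [e] at h
  exact h

/-- A spanning subgraph of `K(A, Aᶜ)` with `|A| = a` and `a (k − a)` edges is all of `K(A, Aᶜ)`. -/
theorem adj_of_bipSub_of_card_edges (D : SimpleGraph V) [DecidableRel D.Adj] (A : Finset V) (hsub : BipSub D A) (a : ℕ) (hA : A.card = a)
    (hD : D.edgeFinset.card = a * (Fintype.card V - a)) {x y : V} (hx : x ∈ A) (hy : y ∉ A) : D.Adj x y := by
  by_contra hnot
  have h0 := card_edges_missingGraph D A hsub a 0 hA (by rw [hD]; omega)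
  have hmem : (missingGraph D A).Adj x y := ⟨by tauto, hnot⟩
  have hpos : 0 < (missingGraph D A).edgeFinset.card := by
    rw [card_pos]
    exact ⟨s(x, y), by rw [SimpleGraph.mem_edgeFinset, SimpleGraph.mem_edgeSet]; exact hmem⟩
  omega

/-- **THE DIAGONAL CELLS, `k ≥ 7`:** a `K₄⁻`-free graph on `Fin k` with `a (k − a)` edges (`3 ≤ a`, `2a ≤ k`)
attains `2·Σ_v C(d(v), 2) = a (k − a) (k − 2)` iff it is complete bipartite spanning with parts of sizes `a`,
`k − a`. -/
theorem diagonal_maximisers (k a : ℕ) (ha : 3 ≤ a) (hak : 2 * a ≤ k) (hk7 : 7 ≤ k) (D : SimpleGraph (Fin k))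
    [DecidableRel D.Adj] (hK : K4mFree D) (hD : D.edgeFinset.card = a * (k - a)) :
    2 * cherries D = a * (k - a) * (k - 2) ↔
      ∃ A : Finset (Fin k), A.card = a ∧ ∀ x y, D.Adj x y ↔ Xor (x ∈ A) (y ∈ A) := by
  have h := closed_form_equality_locus k a 0 ha (by omega) (by omega) D hK (by rw [hD]; rfl)
  simp only [Nat.sub_zero, zero_mul, add_zero] at h
  rw [h]
  have hcard : Fintype.card (Fin k) = k := Fintype.card_fin k
  constructor
  · rintro ⟨A, v, hA, hsub, -⟩
    refine ⟨A, hA, fun x y => ?_⟩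
    have hD' : D.edgeFinset.card = a * (Fintype.card (Fin k) - a) := by rw [hcard]; exact hD
    constructor
    · intro hxy
      have := hsub x y hxy
      unfold Xor
      tauto
    · intro hxor
      rcases hxor with ⟨hx, hy⟩ | ⟨hy, hx⟩
      · exact adj_of_bipSub_of_card_edges D A hsub a hA hD' hx hy
      · exact (adj_of_bipSub_of_card_edges D A hsub a hA hD' hy hx).symm
  · rintro ⟨A, hA, hxor⟩
    refine ⟨A, ⟨0, by omega⟩, hA, bipSub_of_xor D A hxor, fun x y hx hy hnot => ?_⟩
    exfalso
    apply hnot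
    rw [hxor]
    exact Or.inl ⟨hx, hy⟩

end C047

end TriangleCap

end PercRepro
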